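import Summits.ValiantsHypothesis.ValiantsHypothesis.Theorems.KPlusLogSqLawTropicalBComparabilityNested

/-!
# `TropicalB` (stmt-ValiantsHypothesis-19771) — the NESTED LINEAR LAW for three-register comparability chains, part 2:
# `≤ (3·(N + (3U+4)·L₂) + 1)·L₁` dominant members; the three-link law WITHOUT logarithms; the QUADRATIC law for bounded
# outer states

Helper file for the crux `Theses.KPlusLogSqLaw.TropicalB` (`--supports stmt-ValiantsHypothesis-19771 --as helper`), cell
`pub-symmetroid`, seat val-sym-trop-p2 (g6).  Part 1 (`…TropicalBComparabilityNested`, imported) proves that the states of ONE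
middle row occurring in dominant members are `≤ (3(1+U)+1)·L₂` (`ComparabilityChain.card_rowStates_le`).  HONEST FRAMING as in
part 1: a structure theorem about a sub-family of the terms of an arbitrary design, hypotheses verbatim those of g5's
`ComparabilityChain.card_dominant_le_three` (p490014 / p490294); nothing about `TropicalB` in its window, `WeakLifting`,
`MatrixDescartes` (stmt-ValiantsHypothesis-18050) or VP ≠ VNP.

## Results
* `ComparabilityChain.card_dominant_le_nested` — **THE NESTED LINEAR LAW**: at most `(3·(N + (3(1+U)+1)·L₂) + 1)·L₁` members of
  the three-register comparability family are dominant.  PROOF: the middle ROWS `a > y`, each with the `≤ (3U+4)·L₂` states of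
  part 1 (padded to a uniform `U' = min((3U+4)L₂, #feasible states)`), form ONE register against the first register `(j, y)`,
  coupled by the single constraint `y < a`; a dominant member of the three-register family IS a dominant member of this
  projected two-register family (same term), so val-sym-trop-p5 g5's LINEAR COMPARABILITY LAW
  `ComparabilityLinear.card_dominant_le_linear` (p487811) bounds them by `(3(N + U') + 1)·L₁`.
* `ComparabilityChain.card_dominant_le_three'` — g5's THREE-LINK LAW WITHOUT THE LOGARITHMS: `≤ 13·(N+U+1)·L₁·L₂`
  (g5: `(N+U+1)·L₁(⌊log₂L₁⌋+1)·L₂(⌊log₂L₂⌋+1)`).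
* `ComparabilityChain.card_dominant_le_of_third_le` — **QUADRATIC LAW FOR BOUNDED OUTER STATES**: if the third register has at
  most `c` states per position, at most `3N·L₁ + (9c+13)·L₁L₂` members are dominant — LINEAR in the number
  `N·L₁ + L₁L₂ + U·L₂` of register points for every fixed `c`; THREE-PIVOTS R34 (`N = U = 1`, the «cleanest open special
  case» of HOME/val-sym-trop-p2/g5/THREE-PIVOTS.md): `≤ 3L₁ + 22·L₁L₂`.

## What the numbers mean (located; numbers, not adjectives)
The located conjecture of the lineage (g4 R25(a), g5 R33, trop-p5 g5 LINEAR-COMPARABILITY §3) is the QUADRATIC law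
`≤ C·(N·L₁ + L₁L₂ + U·L₂)`.  The nested law is linear in the LARGER outer register and carries the factor `U` only on the
`L₁L₂` term (by the symmetry registers 1 ↔ 3, `L₁ ↔ L₂`, order reversal of positions, the same holds with `N` in place of `U`);
so a super-quadratic count, if any exists, needs MANY states per position on BOTH outer registers (`min(N,U) → ∞`), and the one
remaining target is `Σ_a #(occurring states of row a) = O(N·L₁ + L₁L₂ + U·L₂)` instead of `L₁ · (3U+4)L₂` — the row-visits
question of THREE-PIVOTS R33 in its sharpest form.  For three-pivot interval registers of size `M` (N ≍ U ≍ L₁ ≍ L₂ ≍ M/4) the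
nested law is `≍ M³` against g5's `≍ M³ log² M` and the quartic slope count.
-/

set_option linter.dupNamespace false
set_option autoImplicit false

namespace Summit.ValiantsHypothesis.ValiantsHypothesis.Theorems.KPlusLogSqLaw.ComparabilityChain

open Summit.ValiantsHypothesis.ValiantsHypothesis.Theorems.MatrixDescartes.Negative
open Finset

section Law

variable {m K N L₁ L₂ U : ℕ}
  (d : Fin K → ℕ) (v ε : Fin m → Fin m → Fin K → ℤ)
  (τ : Fin N → Fin L₁ → Fin L₁ → Fin L₂ → Fin L₂ → Fin U → Equiv.Perm (Fin m) × (Fin m → Fin K))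
  (s₁ : Fin N → Fin L₁ → ℤ) (s₂ : Fin L₁ → Fin L₂ → ℤ) (s₃ : Fin L₂ → Fin U → ℤ)
  (A : Fin N → Fin L₁ → ℤ) (W : Fin L₁ → Fin L₂ → ℤ) (B : Fin L₂ → Fin U → ℤ)
  (hinj : ∀ j y a b p u j' y' a' b' p' u', y < a → b < p → y' < a' → b' < p' →
    τ j y a b p u = τ j' y' a' b' p' u' → j = j' ∧ y = y' ∧ a = a' ∧ b = b' ∧ p = p' ∧ u = u')
  (hpres : ∀ j y a b p u, y < a → b < p → termSign ε (τ j y a b p u) ≠ 0)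
  (hw : ∀ j y a b p u (θ : ℤ), y < a → b < p →
    tropWeight d v θ (τ j y a b p u) = θ * (s₁ j y + s₂ a b + s₃ p u) - (A j y + W a b + B p u))

open scoped Classical in
include hinj hpres hw in
/-- **THE NESTED LINEAR LAW.**  Under the hypotheses of `card_dominant_le_three` (three registers, additive slopes and valuations,
members present and pairwise distinct whenever `y < a ∧ b < p`), at most `(3·(N + (3(1+U)+1)·L₂) + 1)·L₁` members are dominant
(each at some integer slope, against all present terms of the design): the middle ROWS `a`, each carrying the `≤ (3(1+U)+1)·L₂`
states of its own right system that ever occur in a dominant member (`card_rowStates_le`), form ONE register of `U' ≤ (3U+4)·L₂`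
states per position against the first register, coupled by `y < a` only — so val-sym-trop-p5's LINEAR law
`ComparabilityLinear.card_dominant_le_linear` applies a second time.  LINEAR in the first register (`3N·L₁`), quadratic in the
rest (`(9U+12)·L₁L₂ + L₁`); no logarithm anywhere. -/
theorem card_dominant_le_nested :
    ((Finset.univ : Finset ((Fin N × Fin L₁ × Fin L₁ × Fin L₂ × Fin L₂ × Fin U))).filter (fun i => (i.2.1 < i.2.2.1 ∧ i.2.2.2.1 < i.2.2.2.2.1) ∧
        ∃ θ : ℤ, IsDominant d v ε θ (τ i.1 i.2.1 i.2.2.1 i.2.2.2.1 i.2.2.2.2.1 i.2.2.2.2.2))).card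
      ≤ (3 * (N + (3 * (1 + U) + 1) * L₂) + 1) * L₁ := by
  classical
  set D := (Finset.univ : Finset ((Fin N × Fin L₁ × Fin L₁ × Fin L₂ × Fin L₂ × Fin U))).filter (fun i => (i.2.1 < i.2.2.1 ∧ i.2.2.2.1 < i.2.2.2.2.1) ∧
        ∃ θ : ℤ, IsDominant d v ε θ (τ i.1 i.2.1 i.2.2.1 i.2.2.2.1 i.2.2.2.2.1 i.2.2.2.2.2)) with hDdef
  have hmemD : ∀ i ∈ D, (i.2.1 < i.2.2.1 ∧ i.2.2.2.1 < i.2.2.2.2.1) ∧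
      ∃ θ : ℤ, IsDominant d v ε θ (τ i.1 i.2.1 i.2.2.1 i.2.2.2.1 i.2.2.2.2.1 i.2.2.2.2.2) :=
    fun i hi => (Finset.mem_filter.1 hi).2
  set M := (3 * (1 + U) + 1) * L₂ with hM
  -- the occurring states of each row, and all feasible states
  let RS : Fin L₁ → Finset (Fin L₂ × Fin L₂ × Fin U) := fun a =>
    (Finset.univ : Finset (Fin L₂ × Fin L₂ × Fin U)).filter (fun s => s.1 < s.2.1 ∧
        ∃ (j : Fin N) (y : Fin L₁) (θ : ℤ), y < a ∧ IsDominant d v ε θ (τ j y a s.1 s.2.1 s.2.2))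
  let F : Finset (Fin L₂ × Fin L₂ × Fin U) := (Finset.univ : Finset (Fin L₂ × Fin L₂ × Fin U)).filter (fun s => s.1 < s.2.1)
  have hRS : ∀ a, (RS a).card ≤ M := fun a => card_rowStates_le d v ε τ s₁ s₂ s₃ A W B hinj hpres hw a
  have hRSF : ∀ a, RS a ⊆ F := by
    intro a s hs
    simp only [RS, F, Finset.mem_filter, Finset.mem_univ, true_and] at hs ⊢
    exact hs.1
  have hmemF : ∀ s, s ∈ F ↔ s.1 < s.2.1 := fun s => by
    simp only [F, Finset.mem_filter, Finset.mem_univ, true_and]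
  -- a uniform number of states per row: `U' = min M |F|`
  set U' := min M F.card with hU'
  have hU'M : U' ≤ M := min_le_left _ _
  have hU'F : U' ≤ F.card := min_le_right _ _
  have hRSU' : ∀ a, (RS a).card ≤ U' := fun a => le_min (hRS a) (Finset.card_le_card (hRSF a))
  have hexS : ∀ a, ∃ Sa : Finset (Fin L₂ × Fin L₂ × Fin U), RS a ⊆ Sa ∧ Sa ⊆ F ∧ Sa.card = U' :=
    fun a => Finset.exists_subsuperset_card_eq (hRSF a) (hRSU' a) hU'F
  choose Sa hSaRS hSaF hSacard using hexS
  -- enumerate the chosen state sets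
  have hceq : ∀ a, Fintype.card ↥(Sa a) = U' := fun a => by rw [Fintype.card_coe]; exact hSacard a
  let eqv : ∀ a : Fin L₁, ↥(Sa a) ≃ Fin U' := fun a => Fintype.equivFinOfCardEq (hceq a)
  let enum : Fin L₁ → Fin U' → Fin L₂ × Fin L₂ × Fin U := fun a i => ((eqv a).symm i).1
  have henum_mem : ∀ a i, enum a i ∈ Sa a := fun a i => ((eqv a).symm i).2
  have henum_feas : ∀ a i, (enum a i).1 < (enum a i).2.1 := fun a i => (hmemF _).1 (hSaF a (henum_mem a i))
  have henum_inj : ∀ a i i', enum a i = enum a i' → i = i' := by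
    intro a i i' h
    have h' : (eqv a).symm i = (eqv a).symm i' := Subtype.ext h
    exact (eqv a).symm.injective h'
  have henum_idx : ∀ a (s : Fin L₂ × Fin L₂ × Fin U) (h : s ∈ Sa a), enum a (eqv a ⟨s, h⟩) = s := by
    intro a s h
    show ((eqv a).symm (eqv a ⟨s, h⟩)).1 = s
    rw [Equiv.symm_apply_apply]
  -- the projected two-register family: first register `(j, y)`, second register = ROWS `a` with states `i < U'`
  let τ' : Fin N → Fin L₁ → Fin L₁ → Fin U' → Equiv.Perm (Fin m) × (Fin m → Fin K) := fun j y a i =>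
    τ j y a (enum a i).1 (enum a i).2.1 (enum a i).2.2
  let s₂' : Fin L₁ → Fin U' → ℤ := fun a i => s₂ a (enum a i).1 + s₃ (enum a i).2.1 (enum a i).2.2
  let B' : Fin L₁ → Fin U' → ℤ := fun a i => W a (enum a i).1 + B (enum a i).2.1 (enum a i).2.2
  have hinj' : ∀ j y a i j' y' a' i', y < a → y' < a' → τ' j y a i = τ' j' y' a' i' →
      j = j' ∧ y = y' ∧ a = a' ∧ i = i' := by
    intro j y a i j' y' a' i' hya hya' h
    obtain ⟨e1, e2, e3, e4, e5, e6⟩ := hinj j y a _ _ _ j' y' a' _ _ _ hya (henum_feas a i) hya' (henum_feas a' i') h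
    subst e3
    exact ⟨e1, e2, rfl, henum_inj a i i' (Prod.ext e4 (Prod.ext e5 e6))⟩
  have hpres' : ∀ j y a i, y < a → termSign ε (τ' j y a i) ≠ 0 :=
    fun j y a i hya => hpres j y a _ _ _ hya (henum_feas a i)
  have hw' : ∀ j y a i (θ : ℤ), y < a →
      tropWeight d v θ (τ' j y a i) = θ * (s₁ j y + s₂' a i) - (A j y + B' a i) := by
    intro j y a i θ hya
    show tropWeight d v θ (τ j y a (enum a i).1 (enum a i).2.1 (enum a i).2.2) =
      θ * (s₁ j y + (s₂ a (enum a i).1 + s₃ (enum a i).2.1 (enum a i).2.2)) -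
        (A j y + (W a (enum a i).1 + B (enum a i).2.1 (enum a i).2.2))
    rw [hw j y a _ _ _ θ hya (henum_feas a i)]
    ring
  have hlin := ComparabilityLinear.card_dominant_le_linear d v ε τ' s₁ s₂' A B' hinj' hpres' hw'
  set D' := (Finset.univ : Finset (Fin N × Fin L₁ × Fin L₁ × Fin U')).filter (fun q => q.2.1 < q.2.2.1 ∧
      ∃ θ : ℤ, IsDominant d v ε θ (τ' q.1 q.2.1 q.2.2.1 q.2.2.2)) with hD'def
  -- inject `D` into `D'`
  rcases D.eq_empty_or_nonempty with hDe | ⟨i₁, hi₁⟩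
  · rw [hDe, Finset.card_empty]; exact Nat.zero_le _
  -- every member's state is an occurring state of its row, hence enumerated
  have hstate : ∀ i ∈ D, i.2.2.2 ∈ Sa i.2.2.1 := by
    intro i hi
    obtain ⟨⟨hya, hbp⟩, θ, hdom⟩ := hmemD i hi
    apply hSaRS
    simp only [RS, Finset.mem_filter, Finset.mem_univ, true_and]
    exact ⟨hbp, i.1, i.2.1, θ, hya, hdom⟩
  have hU'pos : 0 < U' := by
    rw [← hSacard i₁.2.2.1]
    exact Finset.card_pos.2 ⟨_, hstate i₁ hi₁⟩
  let idx : Fin L₁ → (Fin L₂ × Fin L₂ × Fin U) → Fin U' := fun a s =>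
    if h : s ∈ Sa a then eqv a ⟨s, h⟩ else ⟨0, hU'pos⟩
  have hidx : ∀ a s, s ∈ Sa a → enum a (idx a s) = s := by
    intro a s h
    simp only [idx, dif_pos h]
    exact henum_idx a s h
  let φ : (Fin N × Fin L₁ × Fin L₁ × Fin L₂ × Fin L₂ × Fin U) → (Fin N × Fin L₁ × Fin L₁ × Fin U') := fun i =>
    (i.1, i.2.1, i.2.2.1, idx i.2.2.1 i.2.2.2)
  have hφmem : ∀ i ∈ D, φ i ∈ D' := by
    intro i hi
    obtain ⟨⟨hya, hbp⟩, θ, hdom⟩ := hmemD i hi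
    have hs := hstate i hi
    rw [hD'def, Finset.mem_filter]
    refine ⟨Finset.mem_univ _, hya, θ, ?_⟩
    show IsDominant d v ε θ (τ i.1 i.2.1 i.2.2.1 (enum i.2.2.1 (idx i.2.2.1 i.2.2.2)).1
      (enum i.2.2.1 (idx i.2.2.1 i.2.2.2)).2.1 (enum i.2.2.1 (idx i.2.2.1 i.2.2.2)).2.2)
    rw [hidx _ _ hs]
    exact hdom
  have hφinj : Set.InjOn φ ↑D := by
    intro i hi i' hi' h
    have hs := hstate i (Finset.mem_coe.1 hi)
    have hs' := hstate i' (Finset.mem_coe.1 hi')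
    simp only [φ, Prod.mk.injEq] at h
    obtain ⟨e1, e2, e3, e4⟩ := h
    have e5 : i.2.2.2 = i'.2.2.2 := by
      rw [← hidx _ _ hs, ← hidx _ _ hs', e4, e3]
    exact Prod.ext e1 (Prod.ext e2 (Prod.ext e3 e5))
  calc D.card ≤ D'.card := Finset.card_le_card_of_injOn φ hφmem hφinj
    _ ≤ (3 * (N + U') + 1) * L₁ := hlin
    _ ≤ (3 * (N + M) + 1) * L₁ := by
        apply Nat.mul_le_mul_right
        omega


open scoped Classical in
include hinj hpres hw in
/-- **THE NESTED LINEAR LAW, MIRROR FORM** (registers 1 ↔ 3, `L₁ ↔ L₂`, positions reversed): at most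
`(3·(U + (3(1+N)+1)·L₁) + 1)·L₂` members are dominant — linear in the THIRD register.  Proof: `card_dominant_le_nested` for the
re-indexed family `τ̃ u (rev p) (rev b) (rev a) (rev y) j := τ j y a b p u`, whose constraints `rev p < rev b`, `rev a < rev y`
are `b < p`, `y < a`. -/
theorem card_dominant_le_nested_mirror :
    ((Finset.univ : Finset ((Fin N × Fin L₁ × Fin L₁ × Fin L₂ × Fin L₂ × Fin U))).filter (fun i => (i.2.1 < i.2.2.1 ∧ i.2.2.2.1 < i.2.2.2.2.1) ∧
        ∃ θ : ℤ, IsDominant d v ε θ (τ i.1 i.2.1 i.2.2.1 i.2.2.2.1 i.2.2.2.2.1 i.2.2.2.2.2))).card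
      ≤ (3 * (U + (3 * (1 + N) + 1) * L₁) + 1) * L₂ := by
  classical
  set D := (Finset.univ : Finset ((Fin N × Fin L₁ × Fin L₁ × Fin L₂ × Fin L₂ × Fin U))).filter (fun i => (i.2.1 < i.2.2.1 ∧ i.2.2.2.1 < i.2.2.2.2.1) ∧
        ∃ θ : ℤ, IsDominant d v ε θ (τ i.1 i.2.1 i.2.2.1 i.2.2.2.1 i.2.2.2.2.1 i.2.2.2.2.2)) with hDdef
  have hmemD : ∀ i ∈ D, (i.2.1 < i.2.2.1 ∧ i.2.2.2.1 < i.2.2.2.2.1) ∧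
      ∃ θ : ℤ, IsDominant d v ε θ (τ i.1 i.2.1 i.2.2.1 i.2.2.2.1 i.2.2.2.2.1 i.2.2.2.2.2) :=
    fun i hi => (Finset.mem_filter.1 hi).2
  -- the mirrored family
  let τm : Fin U → Fin L₂ → Fin L₂ → Fin L₁ → Fin L₁ → Fin N → Equiv.Perm (Fin m) × (Fin m → Fin K) :=
    fun u q c z x j => τ j x.rev z.rev c.rev q.rev u
  let t₁ : Fin U → Fin L₂ → ℤ := fun u q => s₃ q.rev u
  let t₂ : Fin L₂ → Fin L₁ → ℤ := fun c z => s₂ z.rev c.rev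
  let t₃ : Fin L₁ → Fin N → ℤ := fun x j => s₁ j x.rev
  let A₁ : Fin U → Fin L₂ → ℤ := fun u q => B q.rev u
  let W₂ : Fin L₂ → Fin L₁ → ℤ := fun c z => W z.rev c.rev
  let B₃ : Fin L₁ → Fin N → ℤ := fun x j => A j x.rev
  have hinjm : ∀ u q c z x j u' q' c' z' x' j', q < c → z < x → q' < c' → z' < x' →
      τm u q c z x j = τm u' q' c' z' x' j' → u = u' ∧ q = q' ∧ c = c' ∧ z = z' ∧ x = x' ∧ j = j' := by
    intro u q c z x j u' q' c' z' x' j' hqc hzx hqc' hzx' h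
    obtain ⟨e1, e2, e3, e4, e5, e6⟩ := hinj j x.rev z.rev c.rev q.rev u j' x'.rev z'.rev c'.rev q'.rev u'
      (Fin.rev_lt_rev.2 hzx) (Fin.rev_lt_rev.2 hqc) (Fin.rev_lt_rev.2 hzx') (Fin.rev_lt_rev.2 hqc') h
    exact ⟨e6, Fin.rev_injective e5, Fin.rev_injective e4, Fin.rev_injective e3, Fin.rev_injective e2, e1⟩
  have hpresm : ∀ u q c z x j, q < c → z < x → termSign ε (τm u q c z x j) ≠ 0 :=
    fun u q c z x j hqc hzx => hpres j x.rev z.rev c.rev q.rev u (Fin.rev_lt_rev.2 hzx) (Fin.rev_lt_rev.2 hqc)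
  have hwm : ∀ u q c z x j (θ : ℤ), q < c → z < x →
      tropWeight d v θ (τm u q c z x j) = θ * (t₁ u q + t₂ c z + t₃ x j) - (A₁ u q + W₂ c z + B₃ x j) := by
    intro u q c z x j θ hqc hzx
    show tropWeight d v θ (τ j x.rev z.rev c.rev q.rev u) =
      θ * (s₃ q.rev u + s₂ z.rev c.rev + s₁ j x.rev) - (B q.rev u + W z.rev c.rev + A j x.rev)
    rw [hw j x.rev z.rev c.rev q.rev u θ (Fin.rev_lt_rev.2 hzx) (Fin.rev_lt_rev.2 hqc)]
    ring
  have h := card_dominant_le_nested d v ε τm t₁ t₂ t₃ A₁ W₂ B₃ hinjm hpresm hwm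
  set Dm := (Finset.univ : Finset ((Fin U × Fin L₂ × Fin L₂ × Fin L₁ × Fin L₁ × Fin N))).filter (fun i => (i.2.1 < i.2.2.1 ∧ i.2.2.2.1 < i.2.2.2.2.1) ∧
        ∃ θ : ℤ, IsDominant d v ε θ (τm i.1 i.2.1 i.2.2.1 i.2.2.2.1 i.2.2.2.2.1 i.2.2.2.2.2)) with hDmdef
  let ψ : (Fin N × Fin L₁ × Fin L₁ × Fin L₂ × Fin L₂ × Fin U) → (Fin U × Fin L₂ × Fin L₂ × Fin L₁ × Fin L₁ × Fin N) :=
    fun i => (i.2.2.2.2.2, i.2.2.2.2.1.rev, i.2.2.2.1.rev, i.2.2.1.rev, i.2.1.rev, i.1)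
  have hψmem : ∀ i ∈ D, ψ i ∈ Dm := by
    intro i hi
    obtain ⟨⟨hya, hbp⟩, θ, hdom⟩ := hmemD i hi
    rw [hDmdef, Finset.mem_filter]
    refine ⟨Finset.mem_univ _, ⟨Fin.rev_lt_rev.2 hbp, Fin.rev_lt_rev.2 hya⟩, θ, ?_⟩
    show IsDominant d v ε θ (τ i.1 i.2.1.rev.rev i.2.2.1.rev.rev i.2.2.2.1.rev.rev i.2.2.2.2.1.rev.rev i.2.2.2.2.2)
    simp only [Fin.rev_rev]
    exact hdom
  have hψinj : Set.InjOn ψ ↑D := by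
    intro i _ i' _ hψ
    simp only [ψ, Prod.mk.injEq, Fin.rev_inj] at hψ
    obtain ⟨e6, e5, e4, e3, e2, e1⟩ := hψ
    exact Prod.ext e1 (Prod.ext e2 (Prod.ext e3 (Prod.ext e4 (Prod.ext e5 e6))))
  exact le_trans (Finset.card_le_card_of_injOn ψ hψmem hψinj) h

open scoped Classical in
include hinj hpres hw in
/-- **THE THREE-LINK LAW WITHOUT LOGARITHMS** (corollary): at most `13·(N + U + 1)·L₁·L₂` dominant members — g5's
`card_dominant_le_three` (`(N+U+1)·L₁(⌊log₂L₁⌋+1)·L₂(⌊log₂L₂⌋+1)`) with both logarithms removed. -/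
theorem card_dominant_le_three' :
    ((Finset.univ : Finset ((Fin N × Fin L₁ × Fin L₁ × Fin L₂ × Fin L₂ × Fin U))).filter (fun i => (i.2.1 < i.2.2.1 ∧ i.2.2.2.1 < i.2.2.2.2.1) ∧
        ∃ θ : ℤ, IsDominant d v ε θ (τ i.1 i.2.1 i.2.2.1 i.2.2.2.1 i.2.2.2.2.1 i.2.2.2.2.2))).card
      ≤ 13 * (N + U + 1) * L₁ * L₂ := by
  classical
  have h := card_dominant_le_nested d v ε τ s₁ s₂ s₃ A W B hinj hpres hw
  rcases Nat.eq_zero_or_pos L₂ with hL₂ | hL₂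
  · -- no feasible member at all (`b < p` is impossible in `Fin 0`)
    subst hL₂
    rw [Finset.card_eq_zero.2]
    · exact Nat.zero_le _
    · refine Finset.filter_false_of_mem ?_
      rintro ⟨_, _, _, b, _, _⟩ _
      exact b.elim0
  · refine h.trans ?_
    have e1 : 3 * N + 1 ≤ (3 * N + 1) * L₂ := Nat.le_mul_of_pos_right _ hL₂
    have e2 : (3 * (N + (3 * (1 + U) + 1) * L₂) + 1) ≤ 13 * (N + U + 1) * L₂ := by
      calc (3 * (N + (3 * (1 + U) + 1) * L₂) + 1) = (3 * N + 1) + (9 * U + 12) * L₂ := by ring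
        _ ≤ (3 * N + 1) * L₂ + (9 * U + 12) * L₂ := Nat.add_le_add_right e1 _
        _ = (3 * N + 9 * U + 13) * L₂ := by ring
        _ ≤ 13 * (N + U + 1) * L₂ := Nat.mul_le_mul_right _ (by omega)
    calc (3 * (N + (3 * (1 + U) + 1) * L₂) + 1) * L₁ ≤ (13 * (N + U + 1) * L₂) * L₁ := Nat.mul_le_mul_right _ e2
      _ = 13 * (N + U + 1) * L₁ * L₂ := by ring

open scoped Classical in
include hinj hpres hw in
/-- **QUADRATIC THREE-LINK LAW FOR BOUNDED OUTER STATES** (corollary): if the third register has at most `c` states per position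
then at most `3·N·L₁ + (9c + 13)·L₁·L₂` members are dominant — LINEAR in the number `N·L₁ + L₁·L₂ + U·L₂` of register points.
In particular THREE-PIVOTS R34 (`N = U = 1`): `≤ 25·L₁·L₂` (`3L₁ + 22 L₁L₂`). -/
theorem card_dominant_le_of_third_le (c : ℕ) (hU : U ≤ c) :
    ((Finset.univ : Finset ((Fin N × Fin L₁ × Fin L₁ × Fin L₂ × Fin L₂ × Fin U))).filter (fun i => (i.2.1 < i.2.2.1 ∧ i.2.2.2.1 < i.2.2.2.2.1) ∧
        ∃ θ : ℤ, IsDominant d v ε θ (τ i.1 i.2.1 i.2.2.1 i.2.2.2.1 i.2.2.2.2.1 i.2.2.2.2.2))).card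
      ≤ 3 * N * L₁ + (9 * c + 13) * L₁ * L₂ := by
  classical
  have h := card_dominant_le_nested d v ε τ s₁ s₂ s₃ A W B hinj hpres hw
  rcases Nat.eq_zero_or_pos L₂ with hL₂ | hL₂
  · subst hL₂
    rw [Finset.card_eq_zero.2]
    · exact Nat.zero_le _
    · refine Finset.filter_false_of_mem ?_
      rintro ⟨_, _, _, b, _, _⟩ _
      exact b.elim0
  · refine h.trans ?_
    have h1 : (3 * (N + (3 * (1 + U) + 1) * L₂) + 1) * L₁ = 3 * N * L₁ + ((9 * U + 12) * L₂ + 1) * L₁ := by ring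
    have e1 : (9 * U + 12) * L₂ * L₁ ≤ (9 * c + 12) * L₂ * L₁ :=
      Nat.mul_le_mul_right _ (Nat.mul_le_mul_right _ (by omega))
    have e2 : L₁ ≤ L₁ * L₂ := Nat.le_mul_of_pos_right _ hL₂
    have h2 : ((9 * U + 12) * L₂ + 1) * L₁ ≤ (9 * c + 13) * L₁ * L₂ := by
      calc ((9 * U + 12) * L₂ + 1) * L₁ = (9 * U + 12) * L₂ * L₁ + L₁ := by ring
        _ ≤ (9 * c + 12) * L₂ * L₁ + L₁ * L₂ := Nat.add_le_add e1 e2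
        _ = (9 * c + 13) * L₁ * L₂ := by ring
    omega

open scoped Classical in
include hinj hpres hw in
/-- **QUADRATIC THREE-LINK LAW FOR BOUNDED OUTER STATES, mirror form**: if the FIRST register has at most `c` states per position
then at most `3·U·L₂ + (9c + 13)·L₁·L₂` members are dominant.  With `card_dominant_le_of_third_le`: the located quadratic law
`O(N·L₁ + L₁L₂ + U·L₂)` holds as soon as `min(N, U)` is bounded. -/
theorem card_dominant_le_of_first_le (c : ℕ) (hN : N ≤ c) :
    ((Finset.univ : Finset ((Fin N × Fin L₁ × Fin L₁ × Fin L₂ × Fin L₂ × Fin U))).filter (fun i => (i.2.1 < i.2.2.1 ∧ i.2.2.2.1 < i.2.2.2.2.1) ∧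
        ∃ θ : ℤ, IsDominant d v ε θ (τ i.1 i.2.1 i.2.2.1 i.2.2.2.1 i.2.2.2.2.1 i.2.2.2.2.2))).card
      ≤ 3 * U * L₂ + (9 * c + 13) * L₁ * L₂ := by
  classical
  have h := card_dominant_le_nested_mirror d v ε τ s₁ s₂ s₃ A W B hinj hpres hw
  rcases Nat.eq_zero_or_pos L₁ with hL₁ | hL₁
  · subst hL₁
    rw [Finset.card_eq_zero.2]
    · exact Nat.zero_le _
    · refine Finset.filter_false_of_mem ?_
      rintro ⟨_, y, _, _, _, _⟩ _
      exact y.elim0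
  · refine h.trans ?_
    have h1 : (3 * (U + (3 * (1 + N) + 1) * L₁) + 1) * L₂ = 3 * U * L₂ + ((9 * N + 12) * L₁ + 1) * L₂ := by ring
    have e1 : (9 * N + 12) * L₁ * L₂ ≤ (9 * c + 12) * L₁ * L₂ :=
      Nat.mul_le_mul_right _ (Nat.mul_le_mul_right _ (by omega))
    have e2 : L₂ ≤ L₁ * L₂ := Nat.le_mul_of_pos_left _ hL₁
    have h2 : ((9 * N + 12) * L₁ + 1) * L₂ ≤ (9 * c + 13) * L₁ * L₂ := by
      calc ((9 * N + 12) * L₁ + 1) * L₂ = (9 * N + 12) * L₁ * L₂ + L₂ := by ring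
        _ ≤ (9 * c + 12) * L₁ * L₂ + L₁ * L₂ := Nat.add_le_add e1 e2
        _ = (9 * c + 13) * L₁ * L₂ := by ring
    omega

end Law

end Summit.ValiantsHypothesis.ValiantsHypothesis.Theorems.KPlusLogSqLaw.ComparabilityChain
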